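import Mathlib
import HarnessLib
import Summits.QuantumFields.YangMills.Theorems.HypercubicLimit.Negative.ReflectedDensity
import Summits.QuantumFields.YangMills.Theorems.FradkinShenkerFlowFiniteSusceptibilityWeakCouplingRPCauchySchwarz
import Literature.MathematicalPhysics.AQFT.OSAxiomsSchwinger
import Literature.MathematicalPhysics.QuantumLattice.LatticeScalarField
import Literature.MathematicalPhysics.QuantumFieldTheory.LatticeGaugeStaticPotentialProofs
import Literature.Probability.LatticeModels.ThermodynamicLimit

/-!
# `HypercubicLimit`, line `conditional-mean-telescoping` (c1 blocks): stub `rpBlock_momentTheta`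

Support file (`--supports stmt-QuantumFields-8646`) for crux
`Summit.QuantumFields.YangMills.Theses.PencilRigidity.HypercubicLimit`, line
`conditional-mean-telescoping`: the registered c1 block `rpBlock_momentTheta` — **the plaquette-string
moment identity under the odd-torus bond reflection** `Θ` (`GaugeConfig.timeReflect`, `t ↦ 1 − t` on the
torus of side `2L+1`).

For a string of torus plaquettes of orientations `q k = (i<j)`, corners `x k ∈ ℤ⁴` and centring constants
`m k`, the centred Wilson moment `∫ ∏ₖ (p_{q k}(x k) − m k) dμ_β` equals the moment of the REFLECTED
string: a temporal plaquette (`i = 0`) based at `x` is replaced by the one based at `θ_ℤ x − e₀`, a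
spatial one (`0 < i`) by the one based at `θ_ℤ x` (`θ_ℤ x = Function.update x 0 (1 - x 0)`).

Route (tree vocabulary only): pointwise, the reflected string evaluated at `U` is the original string
evaluated at `Θ U` (`torusPlaquette_timeReflect_temporal` / `torusPlaquette_timeReflect_spatial` of
`Theorems/HypercubicLimit/Negative/ReflectedDensity.lean`), and `Θ` preserves Wilson's torus measure
(`RPCauchySchwarz.wilsonMeasure_map_timeReflect`), so the two integrals agree by the change of variables
`RPCauchySchwarz.integral_comp_eq`.
-/

noncomputable section

open scoped SchwartzMap ComplexConjugate
open MeasureTheory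
open Literature.MathematicalPhysics.AQFT Literature.MathematicalPhysics.QuantumLattice
open Literature.MathematicalPhysics.QuantumFieldTheory
open Literature.Probability.LatticeModels (box Site)
open Summit.QuantumFields.YangMills.Theorems.HypercubicLimit.Negative (torusPlaquette thetaZ)

namespace Summit.QuantumFields.YangMills.Cruxes.HypercubicLimit.ConditionalMeanTelescoping

/-- Pointwise reflection of one centred plaquette factor: the reflected plaquette (temporal corner
`θ_ℤ x − e₀`, spatial corner `θ_ℤ x`) at `U` is the original plaquette at `Θ U`. [folklore] -/
theorem mTheta_factor_timeReflect {G : Type} [Group G] [TopologicalSpace G] [IsTopologicalGroup G]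
    [CompactSpace G] [MeasurableSpace G] [BorelSpace G] (r : LatticeRep G) (L : ℕ) {i j : Fin 4}
    (hij : i < j) (m : ℝ) (x : Fin 4 → ℤ) (U : GaugeConfig 4 L G) :
    torusPlaquette r L i j (if i = 0 then thetaZ x - Pi.single 0 1 else thetaZ x) U - m =
      torusPlaquette r L i j x U.timeReflect - m := by
  by_cases h0 : i = 0
  · subst h0
    rw [if_pos rfl,
      Summit.QuantumFields.YangMills.Theorems.HypercubicLimit.Negative.torusPlaquette_timeReflect_temporal
        r L hij x U]
  · have hi : 0 < i := Nat.pos_of_ne_zero fun h => h0 (Fin.ext h)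
    rw [if_neg h0,
      Summit.QuantumFields.YangMills.Theorems.HypercubicLimit.Negative.torusPlaquette_timeReflect_spatial
        r L hi hij x U]

/-- A centred plaquette string is a measurable function of the torus configuration. [folklore] -/
theorem mTheta_measurable_string {G : Type} [Group G] [TopologicalSpace G] [IsTopologicalGroup G]
    [CompactSpace G] [MeasurableSpace G] [BorelSpace G] (r : LatticeRep G) (L n : ℕ)
    (q : Fin n → Fin 4 × Fin 4) (m : Fin n → ℝ) (x : Fin n → (Fin 4 → ℤ)) :
    Measurable fun U : GaugeConfig 4 L G =>
      ∏ k, (torusPlaquette r L (q k).1 (q k).2 (x k) U - m k) :=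
  Finset.measurable_prod _ fun k _ =>
    (Summit.QuantumFields.YangMills.Theorems.HypercubicLimit.Negative.measurable_torusPlaquette
      r L (q k).1 (q k).2 (x k)).sub measurable_const

/-- **Block M-θ (moment identity under the odd-torus reflection).** For plaquette strings of
orientations `q k = (i<j)` the centred torus moment is invariant under the corner map of the bond
reflection `Θ : t ↦ 1 − t`: temporal corners go to `θ_ℤ x − e₀`, spatial ones to `θ_ℤ x`
(`torusPlaquette_timeReflect_temporal/_spatial` + `Θ`-invariance of Wilson's torus measure). [folklore] -/
theorem rpBlock_momentTheta :
    ∀ (G : Type) [Group G] [TopologicalSpace G] [IsTopologicalGroup G] [CompactSpace G]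
      [MeasurableSpace G] [BorelSpace G] (r : LatticeRep G) (β : ℝ) (L n : ℕ)
      (q : Fin n → Fin 4 × Fin 4) (m : Fin n → ℝ) (x : Fin n → (Fin 4 → ℤ)),
      (∀ k, (q k).1 < (q k).2) →
        (∫ U, ∏ k, (torusPlaquette r (2 * L + 1) (q k).1 (q k).2 (x k) U - m k)
            ∂(wilsonMeasure r.ρ β : Measure (GaugeConfig 4 (2 * L + 1) G))) =
          ∫ U, ∏ k, (torusPlaquette r (2 * L + 1) (q k).1 (q k).2
              (if (q k).1 = 0 then thetaZ (x k) - Pi.single 0 1 else thetaZ (x k)) U - m k)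
            ∂(wilsonMeasure r.ρ β : Measure (GaugeConfig 4 (2 * L + 1) G)) := by
  intro G _ _ _ _ _ _ r β L n q m x hq
  haveI : NeZero (2 * L + 1) := ⟨by omega⟩
  have hpt : ∀ U : GaugeConfig 4 (2 * L + 1) G,
      (∏ k, (torusPlaquette r (2 * L + 1) (q k).1 (q k).2
          (if (q k).1 = 0 then thetaZ (x k) - Pi.single 0 1 else thetaZ (x k)) U - m k)) =
        ∏ k, (torusPlaquette r (2 * L + 1) (q k).1 (q k).2 (x k) U.timeReflect - m k) :=
    fun U => Finset.prod_congr rfl fun k _ => mTheta_factor_timeReflect r (2 * L + 1) (hq k) (m k) (x k) U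
  simp_rw [hpt]
  exact (Summit.QuantumFields.YangMills.Theorems.FiniteSusceptibilityWeakCoupling.RPCauchySchwarz.integral_comp_eq
    (μ := (wilsonMeasure r.ρ β : Measure (GaugeConfig 4 (2 * L + 1) G)))
    (Θ := GaugeConfig.timeReflect) WilsonRP.measurable_timeReflect
    (Summit.QuantumFields.YangMills.Theorems.FiniteSusceptibilityWeakCoupling.RPCauchySchwarz.wilsonMeasure_map_timeReflect
      r.ρ r.continuous β)
    (mTheta_measurable_string r (2 * L + 1) n q m x)).symm

end Summit.QuantumFields.YangMills.Cruxes.HypercubicLimit.ConditionalMeanTelescoping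

end
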